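import Mathlib
import Summits.Schanuel.Schanuel.Theses.SingularModulusScaling
import Summits.Schanuel.Schanuel.Theses.GaussianStokesSector
import Summits.Schanuel.Schanuel.Theorems.RigidCoreSchanuelOnLogFreeCoreSectorGlue
import Literature.FieldTheory.TranscendenceDegree.AlgebraicDependenceBookkeeping

/-!
# Birth skeleton (BC3) for crux `RelSchanuelOverPiLWField` (stmt-Schanuel-9548)

Routes: `SingularModulusScaling` (this registration), `ExceptionalSubspaces`, `GaussianStokesSector`
(the decl is shared verbatim by the three route files).

The crux is Schanuel's conjecture RELATIVE to the π–Lindemann–Weierstrass field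
`K₂ = ℚ(ℚ̄ ∪ {πi} ∪ e^{ℚ̄})` for tuples `x ∈ ℂⁿ` that are `ℚ`-free modulo the sector
`E₂ = span_ℚ(ℚ̄ ∪ {πi}) = ℚ̄ ⊕ ℚπi`:  `n ≤ trdeg_{K₂} K₂(x, eˣ)`.

This file registers the SECOND SECTOR SPLIT of that statement, along the LOG LATTICE
`L = {z ∈ ℂ | e^z ∈ ℚ̄}` (a `ℚ`-subspace containing `πi`; `L ∩ ℚ̄ = 0` by Hermite–Lindemann):
next sector `E₃ = span_ℚ(ℚ̄ ∪ L) = ℚ̄ ⊕ L ⊇ E₂`, next base field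
`K₃ = ℚ(ℚ̄ ∪ L ∪ e^{ℚ̄}) ⊇ K₂` — the `K₂`-relative analogue of the landed split
`PiFreeOverLWField ∧ RelSchanuelOverPiLWField ⟹ Schanuel`
(`Theorems/RigidCoreSchanuelOnLogFreeCoreSectorGlue.lean`, `SectorGlue.engine`; J. Kirby,
*Exponential algebraicity in exponential fields*, Bull. LMS 42 (2010) §3; M. Waldschmidt,
*Diophantine approximation on linear algebraic groups* (2000) §1.4, Conj. 1.15–1.17):

* `stub_logsAlgIndepOverPiLWField` (INSIDE count = the LOG SECTOR over the π–LW field): logarithms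
  of algebraic numbers `l₁ … l_k` that are `ℚ`-linearly independent modulo `ℚ̄ ⊕ ℚπi` are
  ALGEBRAICALLY independent over `K₂ = ℚ(ℚ̄, πi, e^{ℚ̄})` — the conjecture on algebraic
  independence of logarithms (Waldschmidt 2000 Conj. 1.15; barrier B1
  `Literature.Barriers.Schanuel.AlgebraicIndependenceOfLogarithms`) strengthened to the base
  `K₂` (already `k = 1`: `log 2 ∉ ℚ(π, e, e^{√2}, …)^{alg}` is open);
* `stub_relSchanuelOverLogLWField` (OUTSIDE count = the generic remainder): Schanuel relative to
  `K₃ = ℚ(ℚ̄ ∪ L ∪ e^{ℚ̄})` for tuples `ℚ`-free modulo `E₃ = span_ℚ(ℚ̄ ∪ L)` (its `n = 1`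
  instance at `x = e ∈ K₃`: `e^e ∉ K₃^{alg}` unless `e ∈ ℚ̄ ⊕ L`; it says nothing about the
  logarithms of algebraic numbers themselves, which are scalars of `K₃`).

Both stubs are consequences of Schanuel's conjecture (finite-coefficient descent + Schanuel at
`(a, πi, l, x)` + tower law) and neither gives the crux or `Schanuel` on its own (BC3 probes
recorded in the registrar's NOTES).  The composition
`relSchanuelOverPiLWField_of_pieces : stub₁-sig → stub₂-sig → ⟨crux, unfolded⟩` is PROVED (no
`sorry`): Kirby's `GL_n(ℚ)` base change run over the bottom field `K₂` (`sector_engine`, stated for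
an arbitrary bottom field `K ≤ K'`, sectors `E, E'`), with the inside count obtained from stub 1 by
`inside_count_logs` (write `yᵢ = uᵢ + vᵢ`, `uᵢ ∈ ℚ̄ ⊆ K₂`, `vᵢ ∈ L`; `v` is free modulo `E₂`
because `y` is, `v ⊆ K₂(y)`, so `k ≤ trdeg_{K₂} K₂(y, eʸ)`).  `RelSchanuelOverPiLWField_of`
concludes the crux BY NAME from exactly the two stubs; the corollary `…_gaussianStokesSector`
restates it for the sibling route decl (definitionally equal; the `ExceptionalSubspaces` copy is
the same term and follows by `RelSchanuelOverPiLWField_of` verbatim — its route file is not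
imported here only to keep the import cone small).
The only sorries of the file are the two stubs.
-/

set_option linter.dupNamespace false

namespace Summit.Schanuel.Schanuel.Cruxes.RelSchanuelOverPiLWField.Birth

open Summit.Schanuel.Schanuel.Theses
open IntermediateField Complex Submodule Set Function Literature.FieldTheory.TranscendenceDegree
open Algebra (trdeg)
open Summit.Schanuel.Schanuel.Theorems.RigidCore.SectorGlue

/-! ## The two registered stubs -/

/-- **STUB 1 (inside count): the log sector over the π–LW field.**
If `l₁, …, l_k ∈ ℂ` have ALGEBRAIC exponentials `e^{lᵢ} ∈ ℚ̄` and are `ℚ`-linearly independent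
modulo `E₂ = span_ℚ(ℚ̄ ∪ {πi})` (equivalently, by Hermite–Lindemann, `πi, l₁, …, l_k` are
`ℚ`-linearly independent), then `l₁, …, l_k` are algebraically independent over the π–LW field
`K₂ = ℚ(ℚ̄ ∪ {πi} ∪ e^{ℚ̄})` (algebraic independence of logarithms of algebraic numbers, relative to
`K₂`; a consequence of Schanuel's conjecture; open already for `k = 1`, `l₁ = log 2`:
"`log 2` is transcendental over `ℚ(π, e, e^{√2}, …)`"). -/
theorem stub_logsAlgIndepOverPiLWField :
    ∀ (k : ℕ) (l : Fin k → ℂ), (∀ i, IsAlgebraic ℚ (Complex.exp (l i))) →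
      LinearIndependent ℚ ((Submodule.span ℚ
        ({z : ℂ | IsAlgebraic ℚ z} ∪ {(Real.pi : ℂ) * Complex.I})).mkQ ∘ l) →
      AlgebraicIndependent
        ↥(IntermediateField.adjoin ℚ ({z : ℂ | IsAlgebraic ℚ z} ∪ {(Real.pi : ℂ) * Complex.I} ∪
          Complex.exp '' {z : ℂ | IsAlgebraic ℚ z})) l := by
  sorry

/-- **STUB 2 (outside count): relative Schanuel over the log–LW field.**
If `x₁, …, xₙ ∈ ℂ` are `ℚ`-linearly independent modulo
`E₃ = span_ℚ(ℚ̄ ∪ {z | e^z ∈ ℚ̄})`, then `n ≤ trdeg_{K₃} K₃(x, eˣ)` for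
`K₃ = ℚ(ℚ̄ ∪ {z | e^z ∈ ℚ̄} ∪ e^{ℚ̄})` (Schanuel's conjecture relative to the field generated by the
algebraic numbers, their logarithms and their exponentials; a consequence of Schanuel's
conjecture; its `n = 1` instance at `x = e`: `e^e` is transcendental over `K₃` unless
`e ∈ ℚ̄ ⊕ {z | e^z ∈ ℚ̄}`). -/
theorem stub_relSchanuelOverLogLWField :
    ∀ (n : ℕ) (x : Fin n → ℂ),
      LinearIndependent ℚ ((Submodule.span ℚ
        ({z : ℂ | IsAlgebraic ℚ z} ∪ {z : ℂ | IsAlgebraic ℚ (Complex.exp z)})).mkQ ∘ x) →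
      (n : Cardinal) ≤ Algebra.trdeg
        ↥(IntermediateField.adjoin ℚ
            ({z : ℂ | IsAlgebraic ℚ z} ∪ {z : ℂ | IsAlgebraic ℚ (Complex.exp z)} ∪
              Complex.exp '' {z : ℂ | IsAlgebraic ℚ z}))
        ↥(IntermediateField.adjoin
            ↥(IntermediateField.adjoin ℚ
              ({z : ℂ | IsAlgebraic ℚ z} ∪ {z : ℂ | IsAlgebraic ℚ (Complex.exp z)} ∪
                Complex.exp '' {z : ℂ | IsAlgebraic ℚ z}))
            (Set.range x ∪ Set.range (Complex.exp ∘ x))) := by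
  sorry

/-! ## Notation (purely syntactic abbreviations of the sets in the crux and the stubs) -/

set_option quotPrecheck false in
/-- The algebraic numbers. -/
local notation "𝔸" => ({z : ℂ | IsAlgebraic ℚ z} : Set ℂ)
set_option quotPrecheck false in
/-- The log lattice `L = {z | e^z algebraic}`. -/
local notation "𝕃" => ({z : ℂ | IsAlgebraic ℚ (Complex.exp z)} : Set ℂ)
/-- `πi`. -/
local notation "πI" => ((Real.pi : ℂ) * Complex.I)
set_option quotPrecheck false in
/-- The π–LW field `K₂ = ℚ(ℚ̄ ∪ {πi} ∪ e^{ℚ̄})` (the base field of the crux). -/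
local notation "K₂" => (IntermediateField.adjoin ℚ (𝔸 ∪ {πI} ∪ Complex.exp '' 𝔸))
set_option quotPrecheck false in
/-- The log–LW field `K₃ = ℚ(ℚ̄ ∪ L ∪ e^{ℚ̄})` (the base field of stub 2). -/
local notation "K₃" => (IntermediateField.adjoin ℚ (𝔸 ∪ 𝕃 ∪ Complex.exp '' 𝔸))

/-! ## Bookkeeping lemmas -/

/-- Base change DOWN only increases the transcendence degree generated by a finite set, across
different scalar fields: for subfields `F₁ ⊆ F₂` of `ℂ` (given as intermediate fields over
possibly different base fields) and finite `S`, `trdeg_{F₂} F₂(S) ≤ trdeg_{F₁} F₁(S)`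
(a transcendence basis of `S` over `F₂` stays algebraically independent over `F₁`;
`SectorGlue.trdeg_adjoin_antitone_base` is the case of a common base `ℚ`). [folklore] -/
theorem trdeg_adjoin_antitone_base' {K K' : Type} [Field K] [Field K'] [Algebra K ℂ]
    [Algebra K' ℂ] (F₁ : IntermediateField K ℂ) (F₂ : IntermediateField K' ℂ)
    (h12 : ∀ w : ℂ, w ∈ F₁ → w ∈ F₂) (S : Set ℂ) (hS : S.Finite) :
    trdeg F₂ (adjoin F₂ S) ≤ trdeg F₁ (adjoin F₁ S) := by
  obtain ⟨t, ht⟩ := (AlgebraicIndependent.matroid F₂ ℂ).exists_isBasis S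
  obtain ⟨hti, hts, hta⟩ := AlgebraicIndependent.matroid_isBasis_iff.1 ht
  have htf := hS.subset hts
  have hle : adjoin F₂ S ≤ (algebraicClosure (adjoin F₂ t) ℂ).restrictScalars F₂ :=
    adjoin_le_iff.2 fun w hw => mem_algebraicClosure_iff.2 (isAlgebraic_adjoin_iff.2 (hta w hw))
  let φ : F₁ →+* F₂ :=
    { toFun := fun w => ⟨(w : ℂ), h12 _ w.2⟩
      map_one' := rfl
      map_mul' := fun _ _ => rfl
      map_zero' := rfl
      map_add' := fun _ _ => rfl }
  letI : Algebra F₁ F₂ := φ.toAlgebra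
  haveI : IsScalarTower F₁ F₂ ℂ := .of_algebraMap_eq fun _ => rfl
  have hφ : Function.Injective (algebraMap F₁ F₂) := fun a b h =>
    Subtype.ext (congrArg Subtype.val h :)
  calc trdeg F₂ (adjoin F₂ S) ≤ htf.toFinset.card :=
        trdeg_le_card_of_forall_isAlgebraic (adjoin F₂ S).toSubalgebra htf.toFinset
          fun w hw => by
            rw [htf.coe_toFinset, ← isAlgebraic_adjoin_iff]
            exact mem_algebraicClosure_iff.1 (hle hw)
    _ = Cardinal.mk t := by rw [← ncard_eq_toFinset_card t htf, cast_ncard htf]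
    _ ≤ _ := (AlgebraicIndependent.of_comp (adjoin F₁ S).val
        (x := fun i : t => (⟨i, subset_adjoin F₁ S (hts i.2)⟩ : adjoin F₁ S))
        (hti.restrictScalars hφ)).cardinalMk_le_trdeg

/-- Freeness modulo a subspace `N` makes `span_ℚ(x)` disjoint from `N`. [folklore] -/
theorem disjoint_span_of_free {n : ℕ} {x : Fin n → ℂ} (N : Submodule ℚ ℂ)
    (hx : LinearIndependent ℚ (N.mkQ ∘ x)) : Disjoint (span ℚ (range x)) N := by
  rw [disjoint_def]
  intro u hu huN
  obtain ⟨c, rfl⟩ := (mem_span_range_iff_exists_fun ℚ).1 hu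
  have h0 : ∑ i, c i • (N.mkQ ∘ x) i = 0 := by
    have : N.mkQ (∑ i, c i • x i) = 0 := (Submodule.Quotient.mk_eq_zero N).2 huN
    simpa [map_sum, map_smul] using this
  have hc := Fintype.linearIndependent_iff.1 hx c h0
  simp [hc]

/-- Rational combinations of algebraic numbers are algebraic (`span_ℚ ℚ̄ = ℚ̄`). [folklore] -/
theorem isAlgebraic_of_mem_span_alg (u : ℂ) (hu : u ∈ span ℚ 𝔸) : IsAlgebraic ℚ u :=
  mem_algebraicClosure_iff.1 ((span_le (p := Subalgebra.toSubmodule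
    (algebraicClosure ℚ ℂ).toSubalgebra)).2 (fun _ hw => mem_algebraicClosure_iff.2 hw) hu)

/-- The log lattice is a `ℚ`-subspace: rational combinations of logarithms of algebraic numbers
have algebraic exponentials (`e^{Σ cⱼ lⱼ} = Π (e^{lⱼ})^{cⱼ}` up to roots). [folklore] -/
theorem isAlgebraic_exp_of_mem_span_log (v : ℂ) (hv : v ∈ span ℚ 𝕃) :
    IsAlgebraic ℚ (exp v) := by
  rw [← mem_algebraicClosure_iff]
  induction hv using Submodule.span_induction with
  | mem z hz => exact mem_algebraicClosure_iff.2 hz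
  | zero => rw [exp_zero]; exact one_mem _
  | add u w _ _ hu hw => rw [exp_add]; exact mul_mem hu hw
  | smul c u _ hu => rw [Rat.smul_def]; exact exp_rat_mul_mem_algebraicClosure ℚ u c hu

/-- Elements of the log sector `E₃ = span_ℚ(ℚ̄ ∪ L)` split as `u + v`, `u` algebraic, `v ∈ L`.
[folklore] -/
theorem exists_eq_alg_add_log_of_mem_span (a : ℂ) (ha : a ∈ span ℚ (𝔸 ∪ 𝕃)) :
    ∃ u : ℂ, IsAlgebraic ℚ u ∧ ∃ v : ℂ, IsAlgebraic ℚ (exp v) ∧ a = u + v := by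
  rw [span_union, mem_sup] at ha
  obtain ⟨u, hu, v, hv, rfl⟩ := ha
  exact ⟨u, isAlgebraic_of_mem_span_alg u hu, v, isAlgebraic_exp_of_mem_span_log v hv, rfl⟩

/-- The π–LW field sits inside the log–LW field (`e^{πi} = -1` is algebraic, so `πi ∈ L`).
[folklore] -/
theorem piLW_le_logLW : K₂ ≤ K₃ := by
  refine adjoin.mono ℚ _ _ ?_
  rintro w ((hw | hw) | hw)
  · exact .inl (.inl hw)
  · refine .inl (.inr ?_)
    rw [mem_singleton_iff] at hw
    subst hw
    show IsAlgebraic ℚ (exp ((Real.pi : ℂ) * I))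
    rw [exp_pi_mul_I]
    exact isAlgebraic_one.neg
  · exact .inr hw

/-- Elements of the log sector `E₃ = span_ℚ(ℚ̄ ∪ L)` and their exponentials lie in the log–LW
field `K₃`. [folklore] -/
theorem mem_logLW_of_mem_span (a : ℂ) (ha : a ∈ span ℚ (𝔸 ∪ 𝕃)) : a ∈ K₃ ∧ exp a ∈ K₃ := by
  obtain ⟨u, hu, v, hv, rfl⟩ := exists_eq_alg_add_log_of_mem_span a ha
  refine ⟨add_mem (subset_adjoin ℚ _ (.inl (.inl hu))) (subset_adjoin ℚ _ (.inl (.inr hv))), ?_⟩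
  rw [exp_add]
  exact mul_mem (subset_adjoin ℚ _ (.inr ⟨u, hu, rfl⟩)) (subset_adjoin ℚ _ (.inl (.inl hv)))

/-! ## The sector engine over an arbitrary bottom field -/

/-- **The sector engine over a bottom field `K`** (Kirby's `GL_n(ℚ)` base change).  Data: a
bottom field `K ≤ ℂ`, a smaller sector `E` and a larger sector `E'` (`ℚ`-subspaces of `ℂ`), and a
larger field `K' ⊇ K` containing `E'` and `e^{E'}`.  If
(INSIDE) every tuple `y ⊂ E'` free modulo `E` has `k ≤ trdeg_K K(y, eʸ)`, and
(OUTSIDE) every tuple `z` free modulo `E'` has `m ≤ trdeg_{K'} K'(z, eᶻ)`,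
then every tuple `x` free modulo `E` has `n ≤ trdeg_K K(x, eˣ)`:
adapted basis `y ⊂ V ⊓ E'`, `z ⊂ U` of `V = span_ℚ(x) = (V ⊓ E') ⊕ U`, inside count at `y`
(free modulo `E` because `V ⊓ E = 0`), outside count at `z` (free modulo `E'`), base change DOWN
`K' ↝ K(y, eʸ)`, tower law, and `K(y, eʸ, z, eᶻ) ⊆ K(x, eˣ)^{alg}`. [folklore] -/
theorem sector_engine (K K' : IntermediateField ℚ ℂ) (E E' : Submodule ℚ ℂ) (hKK' : K ≤ K')
    (hE'K' : ∀ a ∈ E', a ∈ K' ∧ exp a ∈ K')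
    (hIn : ∀ (k : ℕ) (y : Fin k → ℂ), (∀ i, y i ∈ E') → LinearIndependent ℚ (E.mkQ ∘ y) →
      (k : Cardinal) ≤ trdeg K (adjoin K (range y ∪ range (exp ∘ y))))
    (hOut : ∀ (m : ℕ) (z : Fin m → ℂ), LinearIndependent ℚ (E'.mkQ ∘ z) →
      (m : Cardinal) ≤ trdeg K' (adjoin K' (range z ∪ range (exp ∘ z)))) :
    ∀ (n : ℕ) (x : Fin n → ℂ), LinearIndependent ℚ (E.mkQ ∘ x) →
      (n : Cardinal) ≤ trdeg K (adjoin K (range x ∪ range (exp ∘ x))) := by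
  intro n x hx
  have hAC : ∀ {R : Type} [Field R] [Algebra R ℂ] {w : ℂ},
      w ∈ algebraicClosure R ℂ ↔ IsAlgebraic R w := mem_algebraicClosure_iff
  have hxli : LinearIndependent ℚ x := LinearIndependent.of_comp _ hx
  set V : Submodule ℚ ℂ := span ℚ (range x) with hV
  haveI : FiniteDimensional ℚ V := FiniteDimensional.span_of_finite ℚ (finite_range x)
  obtain ⟨U', hU'⟩ := (V ⊓ E').exists_isCompl
  set W : Submodule ℚ ℂ := V ⊓ E'
  set U : Submodule ℚ ℂ := V ⊓ U' with hU
  haveI : FiniteDimensional ℚ W := finiteDimensional_of_le inf_le_left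
  haveI : FiniteDimensional ℚ U := finiteDimensional_of_le inf_le_left
  have hsup : W ⊔ U = V := by
    rw [hU, inf_comm, ← sup_inf_assoc_of_le U' (inf_le_left : W ≤ V), hU'.sup_eq_top, top_inf_eq]
  have hdj : Disjoint W U := hU'.disjoint.mono_right inf_le_right
  set k := Module.finrank ℚ W
  set m := Module.finrank ℚ U
  have hn : k + m = n := by
    have h1 := finrank_sup_add_finrank_inf_eq W U
    rw [hdj.eq_bot, finrank_bot, add_zero, hsup, hV, finrank_span_eq_card hxli,
      Fintype.card_fin] at h1
    exact h1.symm
  let bW := Module.finBasis ℚ W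
  let bU := Module.finBasis ℚ U
  let y : Fin k → ℂ := fun i => bW i
  let z : Fin m → ℂ := fun j => bU j
  have hyli : LinearIndependent ℚ y := bW.linearIndependent.map' W.subtype W.ker_subtype
  have hzli : LinearIndependent ℚ z := bU.linearIndependent.map' U.subtype U.ker_subtype
  have hyE' : ∀ i, y i ∈ E' := fun i => (bW i).2.2
  have hyfree : LinearIndependent ℚ (E.mkQ ∘ y) := by
    refine hyli.map ?_
    rw [ker_mkQ]
    exact (disjoint_span_of_free _ hx).mono_left
      (span_le.2 (range_subset_iff.2 fun i => (bW i).2.1))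
  have hzE' : LinearIndependent ℚ (E'.mkQ ∘ z) := by
    refine hzli.map ?_
    rw [ker_mkQ, disjoint_def]
    intro u hu huE
    have huU : u ∈ U := span_le.2 (range_subset_iff.2 fun j => (bU j).2) hu
    exact disjoint_def.1 hdj u ⟨huU.1, huE⟩ huU
  set Sy := range y ∪ range (exp ∘ y)
  set Sz := range z ∪ range (exp ∘ z)
  set Ky := adjoin K Sy
  set Kx := adjoin K (range x ∪ range (exp ∘ x))
  have hKyK' : ∀ w : ℂ, w ∈ Ky → w ∈ K' := by
    intro w hw
    have hle : Ky ≤ IntermediateField.extendScalars hKK' := adjoin_le_iff.2 (by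
      rintro _ (⟨i, rfl⟩ | ⟨i, rfl⟩)
      · exact (hE'K' _ (hyE' i)).1
      · exact (hE'K' _ (hyE' i)).2)
    exact (IntermediateField.mem_extendScalars hKK').1 (hle hw)
  have hVK : ∀ a ∈ V, a ∈ Kx ∧ exp a ∈ algebraicClosure Kx ℂ := by
    intro a ha
    obtain ⟨c, rfl⟩ := (mem_span_range_iff_exists_fun ℚ).1 ha
    refine ⟨sum_mem fun i _ => ?_, ?_⟩
    · rw [Rat.smul_def]
      exact mul_mem (SubfieldClass.ratCast_mem Kx _) (subset_adjoin K _ (.inl ⟨i, rfl⟩))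
    · simp_rw [Rat.smul_def]
      rw [exp_sum]
      exact prod_mem fun i _ => exp_rat_mul_mem_algebraicClosure Kx _ _
        (hAC.2 (isAlgebraic_algebraMap (⟨_, subset_adjoin K _ (.inr ⟨i, rfl⟩)⟩ : Kx)))
  refine (show (n : Cardinal) = k + m by rw [← hn, Nat.cast_add]).trans_le ((add_le_add
    (hIn k y hyE' hyfree) ((hOut m z hzE').trans
    (trdeg_adjoin_antitone_base' Ky K' hKyK' Sz ((finite_range z).union (finite_range _))))).trans
    ((trdeg_add_trdeg_adjoin_le K Sy Sz).trans
    (trdeg_adjoin_le_of_subset_algebraicClosure K Kx _ ?_)))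
  rintro w ((⟨i, rfl⟩ | ⟨i, rfl⟩) | (⟨j, rfl⟩ | ⟨j, rfl⟩))
  · exact hAC.2 (isAlgebraic_algebraMap (⟨_, (hVK _ (bW i).2.1).1⟩ : Kx))
  · exact (hVK _ (bW i).2.1).2
  · exact hAC.2 (isAlgebraic_algebraMap (⟨_, (hVK _ (bU j).2.1).1⟩ : Kx))
  · exact (hVK _ (bU j).2.1).2

/-! ## The inside count over `K₂` from stub 1 -/

/-- **Inside count on the log sector.** Stub 1 implies the `K₂`-relative Schanuel count
`k ≤ trdeg_{K₂} K₂(y, eʸ)` for tuples `y` FROM `E₃ = span_ℚ(ℚ̄ ∪ L)` that are free modulo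
`E₂ = span_ℚ(ℚ̄ ∪ {πi})`: write `yᵢ = uᵢ + vᵢ` with `uᵢ` algebraic (so `uᵢ ∈ K₂`) and `vᵢ ∈ L`;
`v` is free modulo `E₂` (`vᵢ ≡ yᵢ`), stub 1 makes `v` algebraically independent over `K₂`, and
`v ⊆ K₂(y) ⊆ K₂(y, eʸ)`. [folklore] -/
theorem inside_count_logs
    (hP : ∀ (k : ℕ) (l : Fin k → ℂ), (∀ i, IsAlgebraic ℚ (Complex.exp (l i))) →
      LinearIndependent ℚ ((Submodule.span ℚ
        ({z : ℂ | IsAlgebraic ℚ z} ∪ {(Real.pi : ℂ) * Complex.I})).mkQ ∘ l) →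
      AlgebraicIndependent
        ↥(IntermediateField.adjoin ℚ ({z : ℂ | IsAlgebraic ℚ z} ∪ {(Real.pi : ℂ) * Complex.I} ∪
          Complex.exp '' {z : ℂ | IsAlgebraic ℚ z})) l)
    (k : ℕ) (y : Fin k → ℂ) (hy : ∀ i, y i ∈ span ℚ (𝔸 ∪ 𝕃))
    (hfree : LinearIndependent ℚ ((span ℚ (𝔸 ∪ {πI})).mkQ ∘ y)) :
    (k : Cardinal) ≤ trdeg K₂ (adjoin K₂ (range y ∪ range (exp ∘ y))) := by
  choose u hu v hv hyuv using fun i => exists_eq_alg_add_log_of_mem_span _ (hy i)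
  have hvy : ∀ i, v i = y i - u i := fun i => by rw [hyuv i]; ring
  have hvfree : LinearIndependent ℚ ((span ℚ (𝔸 ∪ {πI})).mkQ ∘ v) := by
    have h : (span ℚ (𝔸 ∪ {πI})).mkQ ∘ v = (span ℚ (𝔸 ∪ {πI})).mkQ ∘ y := by
      funext i
      simp only [Function.comp_apply, mkQ_apply]
      rw [Submodule.Quotient.eq, hvy i, sub_sub_cancel_left]
      exact neg_mem (subset_span (.inl (hu i)))
    rw [h]
    exact hfree
  have hind := hP k v hv hvfree
  set F := adjoin K₂ (range y ∪ range (exp ∘ y))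
  have huK : ∀ i, u i ∈ K₂ := fun i => subset_adjoin ℚ _ (.inl (.inl (hu i)))
  have hvF : ∀ i, v i ∈ F := fun i => by
    rw [hvy i]
    exact sub_mem (subset_adjoin K₂ _ (.inl ⟨i, rfl⟩)) (F.algebraMap_mem ⟨u i, huK i⟩)
  have hind' : AlgebraicIndependent K₂ (fun i => (⟨v i, hvF i⟩ : F)) :=
    AlgebraicIndependent.of_comp F.val (by exact hind)
  calc (k : Cardinal) = Cardinal.mk (Fin k) := (Cardinal.mk_fin k).symm
    _ ≤ trdeg K₂ F := hind'.cardinalMk_le_trdeg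

/-! ## The composition -/

/-- **The composition, crux statement UNFOLDED** (PROVED, no sorry): the two stub statements,
verbatim, imply the statement of `RelSchanuelOverPiLWField` — the sector engine along
`E₃ = span_ℚ(ℚ̄ ∪ L)` over `K₃`, bottom field `K₂`, inside count from stub 1 via
`inside_count_logs`, outside count = stub 2.  (Stated with the crux unfolded so that
`RelSchanuelOverPiLWField_of` below is the only theorem concluding the route decl by name.) -/
theorem relSchanuelOverPiLWField_of_pieces
    (hA : ∀ (k : ℕ) (l : Fin k → ℂ), (∀ i, IsAlgebraic ℚ (Complex.exp (l i))) →
      LinearIndependent ℚ ((Submodule.span ℚ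
        ({z : ℂ | IsAlgebraic ℚ z} ∪ {(Real.pi : ℂ) * Complex.I})).mkQ ∘ l) →
      AlgebraicIndependent
        ↥(IntermediateField.adjoin ℚ ({z : ℂ | IsAlgebraic ℚ z} ∪ {(Real.pi : ℂ) * Complex.I} ∪
          Complex.exp '' {z : ℂ | IsAlgebraic ℚ z})) l)
    (hB : ∀ (n : ℕ) (x : Fin n → ℂ),
      LinearIndependent ℚ ((Submodule.span ℚ
        ({z : ℂ | IsAlgebraic ℚ z} ∪ {z : ℂ | IsAlgebraic ℚ (Complex.exp z)})).mkQ ∘ x) →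
      (n : Cardinal) ≤ Algebra.trdeg
        ↥(IntermediateField.adjoin ℚ
            ({z : ℂ | IsAlgebraic ℚ z} ∪ {z : ℂ | IsAlgebraic ℚ (Complex.exp z)} ∪
              Complex.exp '' {z : ℂ | IsAlgebraic ℚ z}))
        ↥(IntermediateField.adjoin
            ↥(IntermediateField.adjoin ℚ
              ({z : ℂ | IsAlgebraic ℚ z} ∪ {z : ℂ | IsAlgebraic ℚ (Complex.exp z)} ∪
                Complex.exp '' {z : ℂ | IsAlgebraic ℚ z}))
            (Set.range x ∪ Set.range (Complex.exp ∘ x)))) :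
    ∀ (n : ℕ) (x : Fin n → ℂ),
      LinearIndependent ℚ ((Submodule.span ℚ
        ({z : ℂ | IsAlgebraic ℚ z} ∪ {(Real.pi : ℂ) * Complex.I})).mkQ ∘ x) →
      (n : Cardinal) ≤ Algebra.trdeg
        ↥(IntermediateField.adjoin ℚ ({z : ℂ | IsAlgebraic ℚ z} ∪ {(Real.pi : ℂ) * Complex.I} ∪
          Complex.exp '' {z : ℂ | IsAlgebraic ℚ z}))
        ↥(IntermediateField.adjoin
            ↥(IntermediateField.adjoin ℚ ({z : ℂ | IsAlgebraic ℚ z} ∪ {(Real.pi : ℂ) * Complex.I} ∪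
              Complex.exp '' {z : ℂ | IsAlgebraic ℚ z}))
            (Set.range x ∪ Set.range (Complex.exp ∘ x))) :=
  sector_engine K₂ K₃ (span ℚ (𝔸 ∪ {πI})) (span ℚ (𝔸 ∪ 𝕃)) piLW_le_logLW
    mem_logLW_of_mem_span (inside_count_logs hA) hB

/-- **The skeleton theorem: the crux BY NAME from exactly the two registered stubs.**
`SingularModulusScaling.RelSchanuelOverPiLWField` (item stmt-Schanuel-9548) follows from
`stub_logsAlgIndepOverPiLWField` and `stub_relSchanuelOverLogLWField` by the proved composition
`relSchanuelOverPiLWField_of_pieces`; the only sorries in its cone are the two stubs. -/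
theorem RelSchanuelOverPiLWField_of : SingularModulusScaling.RelSchanuelOverPiLWField :=
  relSchanuelOverPiLWField_of_pieces stub_logsAlgIndepOverPiLWField stub_relSchanuelOverLogLWField

/-- The same skeleton for the sibling route decl `GaussianStokesSector.RelSchanuelOverPiLWField`
(shared item stmt-Schanuel-9548; definitionally the same statement). -/
theorem RelSchanuelOverPiLWField_of_gaussianStokesSector :
    GaussianStokesSector.RelSchanuelOverPiLWField :=
  RelSchanuelOverPiLWField_of

end Summit.Schanuel.Schanuel.Cruxes.RelSchanuelOverPiLWField.Birth
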